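import Mathlib
import HarnessLib
import Summits.ValiantsHypothesis.ValiantsHypothesis.Theorems.MonotoneRestorationOrbitRestorationQPGluedKill
import Summits.ValiantsHypothesis.ValiantsHypothesis.Theorems.MonotoneRestorationOrbitRestorationQPSimpleGraphCutThreshold

/-!
# Route MonotoneRestoration, crux `OrbitRestorationQP` (stmt-18293) — THE LOSSLESS CUT WITH THE GLUED HALF
# (helper, def-free)

`SimpleGraphCut.orbitRestorationQP_iff_cut_witness` (p825944) certifies `L1 ⟺ W₁ ∧ ¬ PolylogWidthVP`: the crux is its
circuit half `W₁` (width-to-orbit for matrix-symmetric `VP` families determined on simple graphs) plus the non-existence of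
a matrix-symmetric `VP` family separating `≡^{C^{polylog}}`-equivalent simple graphs at their `0/1` adjacency matrices.
`GluedKill.orbitRestorationQP_false_of_gluedSeparating` (p827438) refutes `L1` from the larger class of GLUED witnesses
(separation at `a_m + 1_X` for base points `a_m` fixed by the diagonal action, where one-sorted structure is visible,
cf. `…GluedSees.lean`, p827467).  Hence:

* `orbitRestorationQP_iff_glued_cut` — **`L1 ⟺ W₁ ∧ (no glued-separating matrix-symmetric VP family)`**: the lossless
  cut with the finite-model-theory half enlarged to glued points;
* `not_gluedSeparating_of_cut` — consequently `W₁ ∧ ¬ PolylogWidthVP` already EXCLUDES glued witnesses: granted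
  width-to-orbit, Boolean (two-sorted, double-cover-blind) determinedness of every matrix-symmetric `VP` family forces its
  determinedness at all glued points (one-sorted) — the one-sorted surplus of GAP 2 over H₁ noted in SIMPLE-GRAPH-CUT-g3
  is paid for by `W₁`, in the kernel.

Honest label: propositional glue over landed theorems; nothing closed; VP ≠ VNP untouched. [folklore]
-/

-- `Summit.ValiantsHypothesis.ValiantsHypothesis.…` is the tree's mandated namespace (Sub = Summit).
set_option linter.dupNamespace false

noncomputable section

namespace Summit.ValiantsHypothesis.ValiantsHypothesis.Theorems

namespace GluedKill

open MvPolynomial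
open Summit.ValiantsHypothesis.ValiantsHypothesis.Theses.MonotoneRestoration
open Literature.Computability.AlgebraicComplexity
open Literature.ModelTheory.FiniteModelTheory
open MonotoneRestorationQPLinearWidth

/-- **THE LOSSLESS CUT WITH THE GLUED HALF**: `OrbitRestorationQP ⟺ W₁ ∧ ¬(glued-separating matrix-symmetric VP family)`.
[folklore] -/
theorem orbitRestorationQP_iff_glued_cut :
    OrbitRestorationQP ↔
      ((∀ f : (n : ℕ) → MvPolynomial (Fin n × Fin n) ℂ, IsMatrixSymmetric f → IsVPFamily f →
          (∃ c N : ℕ, ∀ m : ℕ, N ≤ m → ∀ X Y : SimpleGraph (Fin m),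
            CkEquiv ((Nat.log 2 m + c) ^ c) X Y →
              MvPolynomial.eval (Set.indicator {ij : Fin m × Fin m | X.Adj ij.1 ij.2} 1) (f m) =
                MvPolynomial.eval (Set.indicator {ij : Fin m × Fin m | Y.Adj ij.1 ij.2} 1) (f m)) →
          QPOrbitSymm f) ∧
        ¬ ∃ f : (n : ℕ) → MvPolynomial (Fin n × Fin n) ℂ,
          (∀ (n : ℕ) (σ τ : Equiv.Perm (Fin n)),
            MvPolynomial.rename (fun p : Fin n × Fin n => (σ p.1, τ p.2)) (f n) = f n) ∧
          IsVPFamily f ∧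
          ∃ a : (n : ℕ) → Fin n × Fin n → ℂ,
            (∀ (n : ℕ) (σ : Equiv.Perm (Fin n)) (x : Fin n × Fin n), a n (σ • x) = a n x) ∧
            ∀ c N : ℕ, ∃ m : ℕ, N ≤ m ∧ ∃ X Y : SimpleGraph (Fin m),
              CkEquiv ((Nat.log 2 m + c) ^ c) X Y ∧
                eval (fun ij : Fin m × Fin m => Set.indicator {ij : Fin m × Fin m | X.Adj ij.1 ij.2} 1 ij + a m ij)
                    (f m) ≠
                  eval (fun ij : Fin m × Fin m => Set.indicator {ij : Fin m × Fin m | Y.Adj ij.1 ij.2} 1 ij + a m ij)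
                    (f m)) := by
  constructor
  · intro hL1
    exact ⟨(SimpleGraphCut.orbitRestorationQP_iff_cut_witness.mp hL1).1,
      fun h => orbitRestorationQP_false_of_gluedSeparating h hL1⟩
  · rintro ⟨hW, hG⟩
    exact SimpleGraphCut.orbitRestorationQP_iff_cut_witness.mpr
      ⟨hW, fun hH => hG (gluedSeparating_of_polylogWidthVP hH)⟩

/-- **`W₁ ∧ ¬ PolylogWidthVP` excludes glued witnesses**: granted width-to-orbit, Boolean determinedness of all
matrix-symmetric `VP` families on simple graphs forces determinedness at every glued point `a_m + 1_X` (one-sorted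
structure included). [folklore] -/
theorem not_gluedSeparating_of_cut
    (hW : ∀ f : (n : ℕ) → MvPolynomial (Fin n × Fin n) ℂ, IsMatrixSymmetric f → IsVPFamily f →
      (∃ c N : ℕ, ∀ m : ℕ, N ≤ m → ∀ X Y : SimpleGraph (Fin m),
        CkEquiv ((Nat.log 2 m + c) ^ c) X Y →
          MvPolynomial.eval (Set.indicator {ij : Fin m × Fin m | X.Adj ij.1 ij.2} 1) (f m) =
            MvPolynomial.eval (Set.indicator {ij : Fin m × Fin m | Y.Adj ij.1 ij.2} 1) (f m)) →
      QPOrbitSymm f)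
    (hH : ¬ PolylogWidthVP)
    (f : (n : ℕ) → MvPolynomial (Fin n × Fin n) ℂ)
    (hsymm : ∀ (n : ℕ) (σ τ : Equiv.Perm (Fin n)),
      MvPolynomial.rename (fun p : Fin n × Fin n => (σ p.1, τ p.2)) (f n) = f n)
    (hVP : IsVPFamily f) (a : (n : ℕ) → Fin n × Fin n → ℂ)
    (ha : ∀ (n : ℕ) (σ : Equiv.Perm (Fin n)) (x : Fin n × Fin n), a n (σ • x) = a n x) :
    ∃ c N : ℕ, ∀ m : ℕ, N ≤ m → ∀ X Y : SimpleGraph (Fin m),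
      CkEquiv ((Nat.log 2 m + c) ^ c) X Y →
        eval (fun ij : Fin m × Fin m => Set.indicator {ij : Fin m × Fin m | X.Adj ij.1 ij.2} 1 ij + a m ij) (f m) =
          eval (fun ij : Fin m × Fin m => Set.indicator {ij : Fin m × Fin m | Y.Adj ij.1 ij.2} 1 ij + a m ij) (f m) := by
  have hL1 : OrbitRestorationQP := SimpleGraphCut.orbitRestorationQP_iff_cut_witness.mpr ⟨hW, hH⟩
  by_contra hsep
  push Not at hsep
  refine orbitRestorationQP_false_of_gluedSeparating ⟨f, hsymm, hVP, a, ha, fun c N => ?_⟩ hL1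
  obtain ⟨m, hNm, X, Y, hXY, hne⟩ := hsep c N
  exact ⟨m, hNm, X, Y, hXY, hne⟩

end GluedKill

end Summit.ValiantsHypothesis.ValiantsHypothesis.Theorems

end
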